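import Summits.QuantumFields.BalabanUV.InfraRed.StrongCouplingFluxBound
import Summits.QuantumFields.BalabanUV.InfraRed.StrongCouplingReflection
import HarnessLib

/-!
# Strong-coupling front, J-SC16f: the flux bound on `SU(2) ≅ S³` for Frobenius-Lipschitz test functions
("LEMMA F′" of the flux method) —
observatory of the non-perturbative crossover; no mass-gap claim

IR-3 v2 TWO-FRONT CROSSOVER LEDGER, front SC (`β₀`), SU(2), `d = 4`, Wilson normalisation `β_W = 4/g²`.
ABSOLUTE RULE of this package: No internally-minted statement may enter as a cited fact. Every hypothesis is either
kernel-proved in this package or a verbatim quotation of a PUBLISHED theorem with page reference. The manuscript(s)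
under audit are NOT citable for their own disputed steps — they are the thing under adjudication; programme-internal
(2001/route/tribunal) claims are never citable. Nothing is cited in this file: every statement is elementary and
proved here ([folklore] labels are attributions, not citations).

WHAT THIS FILE PROVES (step 2 of the kernel port of the ball-flux certificate for `QuarterCovariance`,
FRONT-SC §3n; it removes the smoothness assumption on the test function of `StrongCouplingFluxBound`):
* `su2Quat_injective`;
* `exists_smooth_approx_quat` — **smooth Lipschitz approximation in quaternion coordinates**: for
  `φ : SU(2) → ℝ` with `|φ a − φ b| ≤ M ‖a − b‖_F` and `ε > 0` there is a smooth `F : ℍ → ℝ` with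
  `‖dF‖ ≤ √2 M` EVERYWHERE and `|F(x_g) − φ(g)| ≤ ε` on `SU(2)` (McShane extension from the unit sphere
  `x(SU(2)) ⊆ ℍ`, where `‖a − b‖_F = √2 |x_a − x_b|` by the tree's `suFrobDist_eq_sqrt_two_mul`, and
  mollification by a smooth bump — the tree's `SUNBakryEmery.exists_smooth_approx` pattern, which however
  exports only the tangential bound `Γ ≤ M²` on the group, not the gradient bound inside the ball that a flux needs);
* `abs_integral_lipschitz_mul_inner_le` — **the flux bound for Lipschitz test functions**: for such `φ` and every
  smooth `W : ℍ → ℍ` whose normal trace `⟪W x, x⟫` has Haar mean zero,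
  `|∫ φ(g) ⟪W x_g, x_g⟫ dσ| ≤ √2 M ∫₀¹ (r² ∫ |radialDiv W (rx)| dσ + r³ ∫ |W(rx)| dσ) dr`.
  With `⟪W x, x⟫ = (ℓ(x) − E_μ ℓ) e^{S(x)}` for a tilt `S` and a linear observable `ℓ`, the left side is
  `Z · |Cov_μ(φ, ℓ)|` for `μ = σ^S`: the covariance of the door `QuarterCovariance` is bounded by ball
  integrals of ANY flux with the prescribed trace — the remaining steps of the port are the explicit flux of
  §3n, two Cauchy–Schwarz inequalities with slice integration, and the certified series inequality (CERT).
METHOD: `ε`-approximation, the smooth flux bound for `Φ = F − F(0)` (constants integrate to zero against a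
mean-zero trace), `ε → 0`.  No smallness, no numerics.

NOT CLAIMED: `QuarterCovariance` itself or any number; no mass-gap claim.

(v2: identical mathematics to v1; the two `local notation` lines removed and the notations spelled out, so that the
file is lint-free for the kernel lane.)
-/

noncomputable section

open MeasureTheory Filter Finset Real
open scoped NNReal Quaternion Matrix ComplexConjugate BigOperators Matrix.Norms.Frobenius ContDiff Topology
  RealInnerProductSpace
open Matrix Complex
open Literature.MathematicalPhysics.QuantumLattice (su2Quat quatMatrix quatMatrix_mul quatMatrix_su2Quat norm_su2Quat)
open Literature.MathematicalPhysics.QuantumFieldTheory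
open Literature.MathematicalPhysics.QuantumFieldTheory.SUNBakryEmery
open Literature.MathematicalPhysics.QuantumFieldTheory.Balaban1983to89.StrongCouplingVarianceWindow (qI qJ qK)

namespace Summit.QuantumFields.BalabanUV.InfraRed.StrongCouplingLipschitzFlux

open Summit.QuantumFields.BalabanUV.InfraRed.StrongCouplingSphereCalculus
open Summit.QuantumFields.BalabanUV.InfraRed.StrongCouplingFluxBound
open Summit.QuantumFields.BalabanUV.InfraRed.StrongCouplingReflection (suFrobDist_eq_sqrt_two_mul)


/-! ## Smooth Lipschitz approximation in quaternion coordinates -/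

/-- `su2Quat` is injective (`quatMatrix` is a left inverse). [folklore] -/
theorem su2Quat_injective : Function.Injective (su2Quat : Matrix.specialUnitaryGroup (Fin 2) ℂ → ℍ) := by
  intro a b h
  have h' := congrArg quatMatrix h
  rw [quatMatrix_su2Quat, quatMatrix_su2Quat] at h'
  exact Subtype.ext h'

/-- Continuity of `su2Quat`. [folklore] -/
private theorem continuous_su2QuatLF : Continuous (su2Quat : Matrix.specialUnitaryGroup (Fin 2) ℂ → ℍ) := by
  have h : Continuous fun g : Matrix.specialUnitaryGroup (Fin 2) ℂ => quatOfMat (g : Matrix (Fin 2) (Fin 2) ℂ) :=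
    (LinearMap.continuous_of_finiteDimensional quatOfMat).comp continuous_subtype_val
  simpa only [quatOfMat_coe] using h

/-- **Smooth approximation of Frobenius-Lipschitz functions on `SU(2)` by smooth functions on `ℍ`**
(McShane extension from the unit sphere `su2Quat(SU(2)) ⊆ ℍ` and mollification by a smooth bump):
for `φ` with `|φ a − φ b| ≤ M ‖a − b‖_F` and `ε > 0` there is a smooth `F : ℍ → ℝ` with
`‖dF‖ ≤ √2·M` everywhere (`‖a − b‖_F = √2 |x_a − x_b|`) and `|F(x_g) − φ(g)| ≤ ε` on `SU(2)`.
(The tree's `SUNBakryEmery.exists_smooth_approx` does the same on `M_N(ℂ)` but exports only the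
tangential bound `Γ ≤ M²`; the flux method needs the gradient bound INSIDE the ball.) [folklore] -/
theorem exists_smooth_approx_quat {φ : Matrix.specialUnitaryGroup (Fin 2) ℂ → ℝ} {M : ℝ} (hM : 0 ≤ M)
    (hφ : ∀ a b : Matrix.specialUnitaryGroup (Fin 2) ℂ, |φ a - φ b| ≤ M * suFrobDist a b) {ε : ℝ} (hε : 0 < ε) :
    ∃ F : ℍ → ℝ, ContDiff ℝ ∞ F ∧ (∀ y : ℍ, ‖fderiv ℝ F y‖ ≤ Real.sqrt 2 * M) ∧
      ∀ g : Matrix.specialUnitaryGroup (Fin 2) ℂ, |F (su2Quat g) - φ g| ≤ ε := by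
  classical
  have hM2 : 0 ≤ Real.sqrt 2 * M := mul_nonneg (Real.sqrt_nonneg _) hM
  set M' : NNReal := ⟨Real.sqrt 2 * M, hM2⟩ with hM'
  set s : Set ℍ := Set.range (su2Quat : Matrix.specialUnitaryGroup (Fin 2) ℂ → ℍ) with hs
  set f : ℍ → ℝ := fun x => if hx : ∃ g : Matrix.specialUnitaryGroup (Fin 2) ℂ, su2Quat g = x then φ hx.choose else 0 with hf
  have hfφ : ∀ g : Matrix.specialUnitaryGroup (Fin 2) ℂ, f (su2Quat g) = φ g := by
    intro g
    have hx : ∃ g' : Matrix.specialUnitaryGroup (Fin 2) ℂ, su2Quat g' = su2Quat g := ⟨g, rfl⟩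
    simp only [hf, dif_pos hx]
    exact congrArg φ (su2Quat_injective hx.choose_spec)
  have hfs : LipschitzOnWith M' f s := by
    refine LipschitzOnWith.of_dist_le_mul fun x hx y hy => ?_
    obtain ⟨a, rfl⟩ := hx
    obtain ⟨b, rfl⟩ := hy
    rw [hfφ, hfφ, Real.dist_eq, dist_eq_norm]
    have h := hφ a b
    rw [suFrobDist_eq_sqrt_two_mul, ← mul_assoc, mul_comm M] at h
    exact h
  -- McShane extension
  obtain ⟨ψe, hψe_lip, hψe_eq⟩ := hfs.extend_real
  have hψe_cont : Continuous ψe := hψe_lip.continuous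
  have hψeφ : ∀ g : Matrix.specialUnitaryGroup (Fin 2) ℂ, ψe (su2Quat g) = φ g := fun g => by
    rw [← hψe_eq ⟨g, rfl⟩, hfφ]
  -- mollification
  borelize ℍ
  set μ : Measure ℍ := Measure.addHaar with hμ
  have hε2 : 0 < ε / (Real.sqrt 2 * M + 1) := div_pos hε (by linarith)
  set ρ : ContDiffBump (0 : ℍ) :=
    ⟨ε / (Real.sqrt 2 * M + 1) / 2, ε / (Real.sqrt 2 * M + 1), half_pos hε2, half_lt_self hε2⟩ with hρ
  set F : ℍ → ℝ := MeasureTheory.convolution (ρ.normed μ) ψe (ContinuousLinearMap.lsmul ℝ ℝ) μ with hF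
  have hFdef : ∀ x, F x = ∫ t, ρ.normed μ t * ψe (x - t) ∂μ := fun x => by
    rw [hF, convolution_lsmul]; rfl
  have hFlip : LipschitzWith M' F := by
    refine LipschitzWith.of_dist_le_mul fun x y => ?_
    have hint : ∀ z : ℍ, Integrable (fun t => ρ.normed μ t * ψe (z - t)) μ := fun z =>
      (ρ.continuous_normed.mul (hψe_cont.comp (continuous_const.sub continuous_id))).integrable_of_hasCompactSupport
        (ρ.hasCompactSupport_normed.mul_right)
    rw [Real.dist_eq, hFdef, hFdef, ← integral_sub (hint x) (hint y)]
    calc |∫ t, (ρ.normed μ t * ψe (x - t) - ρ.normed μ t * ψe (y - t)) ∂μ|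
        ≤ ∫ t, |ρ.normed μ t * ψe (x - t) - ρ.normed μ t * ψe (y - t)| ∂μ := abs_integral_le_integral_abs
      _ ≤ ∫ t, ρ.normed μ t * (M' * dist x y) ∂μ := by
          refine integral_mono ((hint x).sub (hint y)).abs ((ρ.continuous_normed.integrable_of_hasCompactSupport
            ρ.hasCompactSupport_normed).mul_const _) fun t => ?_
          rw [← mul_sub, abs_mul, abs_of_nonneg (ρ.nonneg_normed t)]
          refine mul_le_mul_of_nonneg_left ?_ (ρ.nonneg_normed t)
          have h := hψe_lip.dist_le_mul (x - t) (y - t)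
          rw [Real.dist_eq, dist_sub_right] at h
          exact h
      _ = M' * dist x y := by rw [integral_mul_const, ρ.integral_normed, one_mul]
  refine ⟨F, ?_, ?_, ?_⟩
  · exact ρ.hasCompactSupport_normed.contDiff_convolution_left _ ρ.contDiff_normed
      (hψe_cont.locallyIntegrable (μ := μ))
  · intro y
    exact norm_fderiv_le_of_lipschitz ℝ hFlip
  · intro g
    have h := ρ.dist_normed_convolution_le (μ := μ) (x₀ := su2Quat g) (ε := ε)
      hψe_cont.aestronglyMeasurable (fun x hx => ?_)
    · rw [← hψeφ g, ← Real.dist_eq]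
      exact h
    · rw [Real.dist_eq]
      have h1 := hψe_lip.dist_le_mul x (su2Quat g)
      rw [Real.dist_eq] at h1
      refine h1.trans ?_
      have hx' : dist x (su2Quat g) < ε / (Real.sqrt 2 * M + 1) := hx
      calc (M' : ℝ) * dist x (su2Quat g) ≤ (Real.sqrt 2 * M) * (ε / (Real.sqrt 2 * M + 1)) :=
            mul_le_mul_of_nonneg_left hx'.le hM2
        _ ≤ ε := by
            rw [mul_div_assoc', div_le_iff₀ (by linarith)]
            nlinarith

/-! ## The flux bound for Lipschitz test functions -/

/-- **The flux bound for Lipschitz test functions ("LEMMA F′")**: if `φ : SU(2) → ℝ` is `M`-Lipschitz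
for the Frobenius distance and `W : ℍ → ℍ` is a smooth field whose normal trace on `S³` has Haar
mean zero, then
`|∫ φ(g) ⟪W x_g, x_g⟫ dσ| ≤ √2·M · ∫₀¹ (r² ∫ |radialDiv W (r x)| dσ + r³ ∫ |W (r x)| dσ) dr`.
Proof: smooth approximation `F_ε` of `φ` (`exists_smooth_approx_quat`), the smooth flux bound
`abs_integral_mul_inner_le` for `Φ = F_ε − F_ε(0)` (the constant integrates to zero against a
mean-zero trace), and `ε → 0`.  With `⟪W x, x⟫ = (ℓ(x) − E_μ ℓ)·e^{S(x)}` this bounds `Z·Cov_μ(φ, ℓ)`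
for the tilted measure `μ = σ^S` by ball integrals of ANY such flux `W`. [folklore] -/
theorem abs_integral_lipschitz_mul_inner_le {φ : Matrix.specialUnitaryGroup (Fin 2) ℂ → ℝ} {M : ℝ} (hM : 0 ≤ M)
    (hφ : ∀ a b : Matrix.specialUnitaryGroup (Fin 2) ℂ, |φ a - φ b| ≤ M * suFrobDist a b) {W : ℍ → ℍ} (hW : ContDiff ℝ ∞ W)
    (h0 : ∫ g : Matrix.specialUnitaryGroup (Fin 2) ℂ, ⟪W (su2Quat g), su2Quat g⟫ ∂haarProbability (Matrix.specialUnitaryGroup (Fin 2) ℂ) = 0) :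
    |∫ g : Matrix.specialUnitaryGroup (Fin 2) ℂ, φ g * ⟪W (su2Quat g), su2Quat g⟫ ∂haarProbability (Matrix.specialUnitaryGroup (Fin 2) ℂ)| ≤
      Real.sqrt 2 * M * ∫ r in (0 : ℝ)..1, (r ^ 2 * ∫ g : Matrix.specialUnitaryGroup (Fin 2) ℂ, |radialDiv W (r • su2Quat g)| ∂haarProbability (Matrix.specialUnitaryGroup (Fin 2) ℂ) +
        r ^ 3 * ∫ g : Matrix.specialUnitaryGroup (Fin 2) ℂ, ‖W (r • su2Quat g)‖ ∂haarProbability (Matrix.specialUnitaryGroup (Fin 2) ℂ)) := by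
  have hq := continuous_su2QuatLF
  have hφc : Continuous φ := continuous_of_lipschitz_suFrobDist hφ
  have hTc : Continuous fun g : Matrix.specialUnitaryGroup (Fin 2) ℂ => ⟪W (su2Quat g), su2Quat g⟫ := (hW.continuous.comp hq).inner hq
  set C : ℝ := ∫ g : Matrix.specialUnitaryGroup (Fin 2) ℂ, |⟪W (su2Quat g), su2Quat g⟫| ∂haarProbability (Matrix.specialUnitaryGroup (Fin 2) ℂ) with hC
  have hC0 : 0 ≤ C := integral_nonneg fun g => abs_nonneg _
  refine le_of_forall_pos_le_add fun ε hε => ?_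
  have hε' : 0 < ε / (C + 1) := div_pos hε (by linarith)
  obtain ⟨F, hFs, hFd, hFφ⟩ := exists_smooth_approx_quat hM hφ hε'
  -- the normalised approximant
  set Φ : ℍ → ℝ := fun x => F x - F 0 with hΦ
  have hΦs : ContDiff ℝ ∞ Φ := hFs.sub contDiff_const
  have hΦ0 : Φ 0 = 0 := sub_self _
  have hΦd : ∀ y, ‖fderiv ℝ Φ y‖ ≤ Real.sqrt 2 * M := fun y => by
    rw [hΦ, fderiv_sub_const]; exact hFd y
  have hmain := abs_integral_mul_inner_le hΦs hW hΦ0 hΦd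
  -- splitting `φ = Φ ∘ su2Quat + (φ − F ∘ su2Quat) + F 0`
  have hFc : Continuous F := hFs.continuous
  have i1 : Integrable (fun g : Matrix.specialUnitaryGroup (Fin 2) ℂ => Φ (su2Quat g) * ⟪W (su2Quat g), su2Quat g⟫) (haarProbability (Matrix.specialUnitaryGroup (Fin 2) ℂ)) :=
    integrable_of_continuous_SUN ((hΦs.continuous.comp hq).mul hTc) _
  have i2 : Integrable (fun g : Matrix.specialUnitaryGroup (Fin 2) ℂ => (φ g - F (su2Quat g)) * ⟪W (su2Quat g), su2Quat g⟫) (haarProbability (Matrix.specialUnitaryGroup (Fin 2) ℂ)) :=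
    integrable_of_continuous_SUN ((hφc.sub (hFc.comp hq)).mul hTc) _
  have i3 : Integrable (fun g : Matrix.specialUnitaryGroup (Fin 2) ℂ => F 0 * ⟪W (su2Quat g), su2Quat g⟫) (haarProbability (Matrix.specialUnitaryGroup (Fin 2) ℂ)) :=
    integrable_of_continuous_SUN (continuous_const.mul hTc) _
  have i12 : Integrable (fun g : Matrix.specialUnitaryGroup (Fin 2) ℂ => Φ (su2Quat g) * ⟪W (su2Quat g), su2Quat g⟫ +
      (φ g - F (su2Quat g)) * ⟪W (su2Quat g), su2Quat g⟫) (haarProbability (Matrix.specialUnitaryGroup (Fin 2) ℂ)) := i1.add i2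
  have h3 : ∫ g : Matrix.specialUnitaryGroup (Fin 2) ℂ, F 0 * ⟪W (su2Quat g), su2Quat g⟫ ∂haarProbability (Matrix.specialUnitaryGroup (Fin 2) ℂ) = 0 := by
    rw [integral_const_mul, h0, mul_zero]
  have hpt : (fun g : Matrix.specialUnitaryGroup (Fin 2) ℂ => φ g * ⟪W (su2Quat g), su2Quat g⟫) = fun g =>
      (Φ (su2Quat g) * ⟪W (su2Quat g), su2Quat g⟫ + (φ g - F (su2Quat g)) * ⟪W (su2Quat g), su2Quat g⟫) +
        F 0 * ⟪W (su2Quat g), su2Quat g⟫ := by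
    funext g
    simp only [hΦ]
    ring
  have hsplit : ∫ g : Matrix.specialUnitaryGroup (Fin 2) ℂ, φ g * ⟪W (su2Quat g), su2Quat g⟫ ∂haarProbability (Matrix.specialUnitaryGroup (Fin 2) ℂ) =
      ∫ g : Matrix.specialUnitaryGroup (Fin 2) ℂ, Φ (su2Quat g) * ⟪W (su2Quat g), su2Quat g⟫ ∂haarProbability (Matrix.specialUnitaryGroup (Fin 2) ℂ) +
        ∫ g : Matrix.specialUnitaryGroup (Fin 2) ℂ, (φ g - F (su2Quat g)) * ⟪W (su2Quat g), su2Quat g⟫ ∂haarProbability (Matrix.specialUnitaryGroup (Fin 2) ℂ) := by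
    rw [hpt, integral_add i12 i3, integral_add i1 i2, h3, add_zero]
  -- the error term
  have herr : |∫ g : Matrix.specialUnitaryGroup (Fin 2) ℂ, (φ g - F (su2Quat g)) * ⟪W (su2Quat g), su2Quat g⟫ ∂haarProbability (Matrix.specialUnitaryGroup (Fin 2) ℂ)| ≤ ε := by
    have h1 : |∫ g : Matrix.specialUnitaryGroup (Fin 2) ℂ, (φ g - F (su2Quat g)) * ⟪W (su2Quat g), su2Quat g⟫ ∂haarProbability (Matrix.specialUnitaryGroup (Fin 2) ℂ)| ≤
        ∫ g : Matrix.specialUnitaryGroup (Fin 2) ℂ, ε / (C + 1) * |⟪W (su2Quat g), su2Quat g⟫| ∂haarProbability (Matrix.specialUnitaryGroup (Fin 2) ℂ) := by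
      refine (abs_integral_le_integral_abs).trans (integral_mono i2.abs
        ((integrable_of_continuous_SUN (continuous_abs.comp hTc) _).const_mul _) fun g => ?_)
      rw [abs_mul]
      refine mul_le_mul_of_nonneg_right ?_ (abs_nonneg _)
      rw [abs_sub_comm]
      exact hFφ g
    rw [integral_const_mul] at h1
    refine h1.trans ?_
    rw [div_mul_eq_mul_div, div_le_iff₀ (by linarith)]
    nlinarith
  rw [hsplit]
  calc |∫ g : Matrix.specialUnitaryGroup (Fin 2) ℂ, Φ (su2Quat g) * ⟪W (su2Quat g), su2Quat g⟫ ∂haarProbability (Matrix.specialUnitaryGroup (Fin 2) ℂ) +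
        ∫ g : Matrix.specialUnitaryGroup (Fin 2) ℂ, (φ g - F (su2Quat g)) * ⟪W (su2Quat g), su2Quat g⟫ ∂haarProbability (Matrix.specialUnitaryGroup (Fin 2) ℂ)|
      ≤ |∫ g : Matrix.specialUnitaryGroup (Fin 2) ℂ, Φ (su2Quat g) * ⟪W (su2Quat g), su2Quat g⟫ ∂haarProbability (Matrix.specialUnitaryGroup (Fin 2) ℂ)| +
        |∫ g : Matrix.specialUnitaryGroup (Fin 2) ℂ, (φ g - F (su2Quat g)) * ⟪W (su2Quat g), su2Quat g⟫ ∂haarProbability (Matrix.specialUnitaryGroup (Fin 2) ℂ)| := abs_add_le _ _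
    _ ≤ _ := add_le_add hmain herr

end Summit.QuantumFields.BalabanUV.InfraRed.StrongCouplingLipschitzFlux
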